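import Literature.Probability.Process.BrownianBridgeToPoint3SmallBall
import Mathlib.Analysis.SpecificLimits.Normed
import HarnessLib

/-!
# Points are polar for the Brownian bridge in `ℝ³`

Topic `Literature/Probability/Process`; everything here is PROVED (no named fact). For the
Brownian bridge `X` of duration `t > 0` from `x` to `y` in `ℝ³` (the tree's `bridgePath`, driven
by `bm3` on `(WienerQuad, wienerQuad)`) and any point `z`:

* `measure_exists_bridgePath_eq_zero` — **a.s. `X_s ≠ z` for all `s ∈ (0, t)`**;
* `measure_mem_bridgeRange_eq_zero` — hence the range `bridgeRange t x y ω` (a random compact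
  set) misses every `z ∉ {x, y}` almost surely. With the bridge-mixture definition of
  `brownianBridgeToPointRangeLaw3 x y` (law of the range of Brownian motion from `x` conditioned to
  hit `y`) this gives `P_{x→y} {K | z ∈ K} = 0` for `z ∉ {x, y}` — in particular the pole `0` of
  the unit inversion is avoided, the hypothesis under which the avoidance-functional form of
  `KelvinBridgeCovariance` (item `stmt-CriticalPhenomena-5033`) upgrades to the push-forward form.

The proof is the classical covering argument (Lévy 1940; Kakutani 1944: points are polar for
Brownian motion in `d ≥ 2`), run directly on the bridge: on the almost sure event that the driving
path has a Lévy modulus constant `M` on `[0, ⌈t⌉]` (`ae_modulus_bm3`) and `‖B_t‖ ≤ M`, a visit to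
`z` at a time `s ∈ [δ, t − δ]` forces `dist (X_u, z) ≤ A √((n+1)2⁻ⁿ)` at the dyadic grid point
`u = ⌊s2ⁿ⌋2⁻ⁿ ∈ [δ/2, t − δ]` of every scale `n` with `2⁻ⁿ ≤ δ/2` (`exists_grid_near`,
`A = ‖y − x‖/t + M + M/t`); by the small-ball estimate `measure_dist_bridgePath_le` and a union
bound over the `≤ t2ⁿ + 1` grid points this event has probability
`≤ (t+1)(2t/(δ√(πδ)))³A³ (n+1)√((n+1)2⁻ⁿ) → 0` (`measure_grid_le`, `tendsto_succ_mul_sqrt`);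
letting `M ↑ ∞`, `δ ↓ 0` along integers finishes.

## References

* J.-F. Le Gall, *Brownian Motion, Martingales, and Stochastic Calculus*, GTM 274 (2016), Ch. 2
  and Ch. 7 (polar sets). [Legall2016]
* S. Kakutani, *On Brownian motions in n-space*, Proc. Imp. Acad. Tokyo 20 (1944) 648–652
  (points are polar in `d ≥ 2`). [folklore]
-/

noncomputable section

open MeasureTheory ProbabilityTheory TopologicalSpace Set Metric Filter
open scoped NNReal ENNReal Topology Real

namespace Literature.Probability.Process

namespace BrownianBridgeToPoint3

/-! ### The covering argument: points are polar for the bridge -/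

/-- Increments of the bridge path. [folklore] -/
theorem bridgePath_sub (t : ℝ≥0) (x y : E3) (ω : WienerQuad) (s u : ℝ≥0) :
    bridgePath t x y ω s - bridgePath t x y ω u
      = (((s : ℝ) - u) / t) • (y - x) + (bm3 s ω - bm3 u ω) - (((s : ℝ) - u) / t) • bm3 t ω := by
  simp only [bridgePath, sub_div, sub_smul]
  abel

/-- Increments of the bridge path are controlled by those of the driving Brownian motion.
[folklore] -/
theorem dist_bridgePath_le (t : ℝ≥0) (x y : E3) (ω : WienerQuad) (s u : ℝ≥0) :
    dist (bridgePath t x y ω s) (bridgePath t x y ω u)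
      ≤ |(s : ℝ) - u| / t * ‖y - x‖ + dist (bm3 s ω) (bm3 u ω) + |(s : ℝ) - u| / t * ‖bm3 t ω‖ := by
  rw [dist_eq_norm, bridgePath_sub, dist_eq_norm]
  have habs : ‖((s : ℝ) - u) / t‖ = |(s : ℝ) - u| / t := by
    rw [Real.norm_eq_abs, abs_div, abs_of_nonneg (NNReal.coe_nonneg t)]
  calc ‖(((s : ℝ) - u) / t) • (y - x) + (bm3 s ω - bm3 u ω) - (((s : ℝ) - u) / t) • bm3 t ω‖
      ≤ ‖(((s : ℝ) - u) / t) • (y - x) + (bm3 s ω - bm3 u ω)‖ + ‖(((s : ℝ) - u) / t) • bm3 t ω‖ :=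
        norm_sub_le _ _
    _ ≤ ‖(((s : ℝ) - u) / t) • (y - x)‖ + ‖bm3 s ω - bm3 u ω‖ + ‖(((s : ℝ) - u) / t) • bm3 t ω‖ :=
        add_le_add_left (norm_add_le _ _) _
    _ = _ := by rw [norm_smul, norm_smul, habs]

/-- `2⁻ⁿ ≤ √((n+1) 2⁻ⁿ)`. [folklore] -/
theorem inv_two_pow_le_sqrt (n : ℕ) : ((2 : ℝ) ^ n)⁻¹ ≤ Real.sqrt ((n + 1) / 2 ^ n) := by
  have h2 : (0 : ℝ) < 2 ^ n := by positivity
  have h1 : ((2 : ℝ) ^ n)⁻¹ ≤ 1 := inv_le_one_of_one_le₀ (one_le_pow₀ (by norm_num))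
  refine Real.le_sqrt_of_sq_le ?_
  rw [le_div_iff₀ h2]
  calc (((2 : ℝ) ^ n)⁻¹) ^ 2 * 2 ^ n = ((2 : ℝ) ^ n)⁻¹ := by field_simp
    _ ≤ 1 := h1
    _ ≤ n + 1 := by linarith [(Nat.cast_nonneg n : (0 : ℝ) ≤ n)]

/-- **One scale of the covering argument (deterministic).** If the driving path has modulus
constant `M` on `[0, N] ⊇ [0, t]` and `‖B_t‖ ≤ M`, and the bridge hits `z` at a time
`s ∈ [δ, t − δ]`, then at every dyadic scale `n` with `2⁻ⁿ ≤ δ/2` some grid point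
`u = k 2⁻ⁿ ∈ [δ/2, t − δ]` has `dist (X_u, z) ≤ A √((n+1) 2⁻ⁿ)`, `A = ‖y − x‖/t + M + M/t`.
[folklore] -/
theorem exists_grid_near {t : ℝ≥0} {N : ℕ} (htN : (t : ℝ) ≤ N) {x y z : E3} {ω : WienerQuad}
    {M : ℝ} (hmod : ∀ (n : ℕ) (s u : ℝ≥0), s ≤ N → u ≤ N → dist s u ≤ (2 ^ n)⁻¹ →
      dist (bm3 s ω) (bm3 u ω) ≤ M * Real.sqrt ((n + 1) / 2 ^ n))
    (hBt : ‖bm3 t ω‖ ≤ M) {δ : ℝ} {s : ℝ≥0} (hδs : δ ≤ s) (hst : (s : ℝ) + δ ≤ t)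
    (hz : bridgePath t x y ω s = z) {n : ℕ} (hn : ((2 : ℝ) ^ n)⁻¹ ≤ δ / 2) :
    ∃ k : ℕ, δ / 2 ≤ (k : ℝ) / 2 ^ n ∧ (k : ℝ) / 2 ^ n ≤ t - δ ∧
      dist (bridgePath t x y ω ((k : ℝ≥0) / 2 ^ n)) z
        ≤ (‖y - x‖ / t + M + M / t) * Real.sqrt ((n + 1) / 2 ^ n) := by
  have h2 : (0 : ℝ) < 2 ^ n := by positivity
  set k : ℕ := ⌊(s : ℝ) * 2 ^ n⌋₊ with hk
  have hs0 : (0 : ℝ) ≤ s := NNReal.coe_nonneg s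
  have hk1 : (k : ℝ) ≤ (s : ℝ) * 2 ^ n := Nat.floor_le (by positivity)
  have hk2 : (s : ℝ) * 2 ^ n < k + 1 := Nat.lt_floor_add_one _
  set u : ℝ≥0 := (k : ℝ≥0) / 2 ^ n with hu
  have hu' : (u : ℝ) = (k : ℝ) / 2 ^ n := by rw [hu]; push_cast; ring
  have hus : (u : ℝ) ≤ s := by rw [hu', div_le_iff₀ h2]; exact hk1
  have hsu : (s : ℝ) - u ≤ (2 ^ n)⁻¹ := by
    rw [hu', sub_le_iff_le_add]
    have : (s : ℝ) * 2 ^ n ≤ 1 + k := by linarith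
    calc (s : ℝ) = (s : ℝ) * 2 ^ n / 2 ^ n := by field_simp
      _ ≤ (1 + k) / 2 ^ n := div_le_div_of_nonneg_right this h2.le
      _ = (2 ^ n)⁻¹ + k / 2 ^ n := by ring
  have hdist : dist s u ≤ (2 ^ n)⁻¹ := by
    rw [NNReal.dist_eq, abs_of_nonneg (by linarith)]
    exact hsu
  have hM0 : 0 ≤ M := (norm_nonneg _).trans hBt
  refine ⟨k, ?_, ?_, ?_⟩
  · rw [← hu']; linarith
  · rw [← hu']; linarith
  -- the distance estimate
  have hsN : s ≤ N := by
    have : (s : ℝ) ≤ N := by linarith [hδs.trans' (le_refl δ), hst, (show (0:ℝ) ≤ δ / 2 from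
      le_trans (by positivity) hn)]
    exact_mod_cast this
  have huN : u ≤ N := by
    have : (u : ℝ) ≤ N := hus.trans (by exact_mod_cast hsN)
    exact_mod_cast this
  have hB := hmod n s u hsN huN hdist
  have ht0 : (0 : ℝ) ≤ t := NNReal.coe_nonneg t
  set q : ℝ := Real.sqrt ((n + 1) / 2 ^ n) with hq
  have hq2 : ((2 : ℝ) ^ n)⁻¹ ≤ q := inv_two_pow_le_sqrt n
  have habs : |(s : ℝ) - u| ≤ q := by rw [abs_of_nonneg (by linarith)]; exact hsu.trans hq2
  rw [← hz, dist_comm]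
  calc dist (bridgePath t x y ω s) (bridgePath t x y ω u)
      ≤ |(s : ℝ) - u| / t * ‖y - x‖ + dist (bm3 s ω) (bm3 u ω) + |(s : ℝ) - u| / t * ‖bm3 t ω‖ :=
        dist_bridgePath_le t x y ω s u
    _ ≤ q / t * ‖y - x‖ + M * q + q / t * M := by
        gcongr
    _ = (‖y - x‖ / t + M + M / t) * q := by ring

/-- **One scale of the covering argument (probabilistic).** The union over the dyadic grid
points `u = k2⁻ⁿ ∈ [δ/2, t − δ]` of the events `dist (X_u, z) ≤ A√((n+1)2⁻ⁿ)` has probability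
at most `(t + 1) (2t/(δ√(πδ)))³ A³ (n + 1) √((n+1)2⁻ⁿ)`, which tends to `0`. [folklore] -/
theorem measure_grid_le (t : ℝ≥0) (x y z : E3) {δ : ℝ} (hδ : 0 < δ) {A : ℝ} (hA : 0 ≤ A)
    (n : ℕ) :
    wienerQuad (⋃ k ∈ (Finset.range (⌊(t : ℝ) * 2 ^ n⌋₊ + 1)).filter
        (fun k : ℕ => δ / 2 ≤ (k : ℝ) / 2 ^ n ∧ (k : ℝ) / 2 ^ n ≤ t - δ),
        {ω | dist (bridgePath t x y ω ((k : ℝ≥0) / 2 ^ n)) z ≤ A * Real.sqrt ((n + 1) / 2 ^ n)})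
      ≤ ENNReal.ofReal (((t : ℝ) + 1) * (2 * t / (δ * Real.sqrt (π * δ))) ^ 3 * A ^ 3 *
          ((n + 1) * Real.sqrt ((n + 1) / 2 ^ n))) := by
  have h2 : (0 : ℝ) < 2 ^ n := by positivity
  have ht0 : (0 : ℝ) ≤ t := NNReal.coe_nonneg t
  set q : ℝ := Real.sqrt ((n + 1) / 2 ^ n) with hq
  have hq0 : 0 ≤ q := Real.sqrt_nonneg _
  set K : ℕ := ⌊(t : ℝ) * 2 ^ n⌋₊ with hK
  set C₁ : ℝ := (2 * t / (δ * Real.sqrt (π * δ))) ^ 3 with hC₁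
  have hC₁0 : 0 ≤ C₁ := by positivity
  set Fk := (Finset.range (K + 1)).filter
    (fun k : ℕ => δ / 2 ≤ (k : ℝ) / 2 ^ n ∧ (k : ℝ) / 2 ^ n ≤ t - δ) with hFk
  -- the bound for one grid point
  have hone : ∀ k ∈ Fk, wienerQuad {ω | dist (bridgePath t x y ω ((k : ℝ≥0) / 2 ^ n)) z ≤ A * q}
      ≤ ENNReal.ofReal (C₁ * A ^ 3 * q ^ 3) := by
    intro k hk
    rw [hFk, Finset.mem_filter] at hk
    obtain ⟨-, hk1, hk2⟩ := hk
    set u : ℝ≥0 := (k : ℝ≥0) / 2 ^ n with hu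
    have hu' : (u : ℝ) = (k : ℝ) / 2 ^ n := by rw [hu]; push_cast; ring
    have hupos : (0 : ℝ) < u := by rw [hu']; linarith
    have hu0 : u ≠ 0 := by
      intro h; rw [h, NNReal.coe_zero] at hupos; exact lt_irrefl _ hupos
    have hut' : (u : ℝ) < t := by rw [hu']; linarith
    have hut : u < t := by exact_mod_cast hut'
    have htpos : (0 : ℝ) < t := hupos.trans hut'
    refine (measure_dist_bridgePath_le hu0 hut x y z (mul_nonneg hA hq0)).trans
      (ENNReal.ofReal_le_ofReal ?_)
    have h1c : δ / t ≤ 1 - (u : ℝ) / t := by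
      rw [div_le_iff₀ htpos, sub_mul, div_mul_cancel₀ _ htpos.ne', one_mul]
      linarith
    have hδt : 0 < δ / t := div_pos hδ htpos
    have hsq : Real.sqrt (π * δ) ≤ Real.sqrt (2 * π * u) :=
      Real.sqrt_le_sqrt (by nlinarith [Real.pi_pos])
    have hsq0 : 0 < Real.sqrt (π * δ) := Real.sqrt_pos.2 (by positivity)
    have hle : 2 * (A * q / (1 - (u : ℝ) / t)) / Real.sqrt (2 * π * u)
        ≤ 2 * t * (A * q) / (δ * Real.sqrt (π * δ)) := by
      rw [div_le_div_iff₀ (hsq0.trans_le hsq) (by positivity)]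
      have h3 : A * q / (1 - (u : ℝ) / t) ≤ A * q / (δ / t) :=
        div_le_div_of_nonneg_left (by positivity) hδt h1c
      rw [div_div_eq_mul_div] at h3
      calc 2 * (A * q / (1 - (u : ℝ) / t)) * (δ * Real.sqrt (π * δ))
          ≤ 2 * (A * q * t / δ) * (δ * Real.sqrt (2 * π * u)) := by gcongr
        _ = 2 * t * (A * q) * Real.sqrt (2 * π * u) := by field_simp
    have h1c' : 0 < 1 - (u : ℝ) / t := hδt.trans_le h1c
    have hnn : 0 ≤ 2 * (A * q / (1 - (u : ℝ) / t)) / Real.sqrt (2 * π * u) :=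
      div_nonneg (mul_nonneg zero_le_two (div_nonneg (mul_nonneg hA hq0) h1c'.le))
        (Real.sqrt_nonneg _)
    calc (2 * (A * q / (1 - (u : ℝ) / t)) / Real.sqrt (2 * π * u)) ^ 3
        ≤ (2 * t * (A * q) / (δ * Real.sqrt (π * δ))) ^ 3 :=
          pow_le_pow_left₀ hnn hle 3
      _ = C₁ * A ^ 3 * q ^ 3 := by rw [hC₁]; ring
  -- sum over the grid
  have hcard : Fk.card ≤ K + 1 :=
    (Finset.card_filter_le _ _).trans (Finset.card_range _).le
  have hq3 : q ^ 3 = (n + 1) / 2 ^ n * q := by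
    rw [pow_succ, hq, Real.sq_sqrt (by positivity)]
  have hK1 : (K : ℝ) + 1 ≤ ((t : ℝ) + 1) * 2 ^ n := by
    have hKle : (K : ℝ) ≤ (t : ℝ) * 2 ^ n := Nat.floor_le (by positivity)
    have h1 : (1 : ℝ) ≤ 2 ^ n := one_le_pow₀ (by norm_num)
    nlinarith
  calc wienerQuad (⋃ k ∈ Fk, {ω | dist (bridgePath t x y ω ((k : ℝ≥0) / 2 ^ n)) z ≤ A * q})
      ≤ ∑ k ∈ Fk, wienerQuad {ω | dist (bridgePath t x y ω ((k : ℝ≥0) / 2 ^ n)) z ≤ A * q} :=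
        measure_biUnion_finset_le _ _
    _ ≤ ∑ _k ∈ Fk, ENNReal.ofReal (C₁ * A ^ 3 * q ^ 3) := Finset.sum_le_sum hone
    _ = (Fk.card : ℝ≥0∞) * ENNReal.ofReal (C₁ * A ^ 3 * q ^ 3) := by
        rw [Finset.sum_const, nsmul_eq_mul]
    _ ≤ ((K + 1 : ℕ) : ℝ≥0∞) * ENNReal.ofReal (C₁ * A ^ 3 * q ^ 3) := by
        gcongr
    _ = ENNReal.ofReal (((K : ℝ) + 1) * (C₁ * A ^ 3 * q ^ 3)) := by
        rw [ENNReal.ofReal_mul (p := (K : ℝ) + 1) (by positivity)]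
        congr 1
        rw [show ((K : ℝ) + 1) = ((K + 1 : ℕ) : ℝ) by push_cast; ring, ENNReal.ofReal_natCast]
    _ ≤ _ := by
        refine ENNReal.ofReal_le_ofReal ?_
        rw [hq3]
        calc ((K : ℝ) + 1) * (C₁ * A ^ 3 * ((n + 1) / 2 ^ n * q))
            ≤ ((t : ℝ) + 1) * 2 ^ n * (C₁ * A ^ 3 * ((n + 1) / 2 ^ n * q)) :=
              mul_le_mul_of_nonneg_right hK1 (by positivity)
          _ = ((t : ℝ) + 1) * C₁ * A ^ 3 * ((n + 1) * q) := by field_simp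

/-- `(n + 1) √((n+1) 2⁻ⁿ) → 0`. [folklore] -/
theorem tendsto_succ_mul_sqrt :
    Tendsto (fun n : ℕ => ((n : ℝ) + 1) * Real.sqrt ((n + 1) / 2 ^ n)) atTop (𝓝 0) := by
  have h1 : Tendsto (fun n : ℕ => ((n : ℝ)) ^ 3 / 2 ^ n) atTop (𝓝 0) :=
    tendsto_pow_const_div_const_pow_of_one_lt 3 one_lt_two
  have h2 : Tendsto (fun n : ℕ => (((n + 1 : ℕ) : ℝ)) ^ 3 / 2 ^ (n + 1)) atTop (𝓝 0) :=
    h1.comp (tendsto_add_atTop_nat 1)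
  have h3 : Tendsto (fun n : ℕ => Real.sqrt (2 * ((((n + 1 : ℕ) : ℝ)) ^ 3 / 2 ^ (n + 1))))
      atTop (𝓝 0) := by
    have := (h2.const_mul 2).sqrt
    rwa [mul_zero, Real.sqrt_zero] at this
  refine h3.congr fun n => ?_
  have hn : (0 : ℝ) ≤ n + 1 := by positivity
  rw [show (2 : ℝ) * ((((n + 1 : ℕ) : ℝ)) ^ 3 / 2 ^ (n + 1)) = ((n : ℝ) + 1) ^ 2 * ((n + 1) / 2 ^ n)
    by push_cast; rw [pow_succ]; field_simp; ring, Real.sqrt_mul (sq_nonneg _), Real.sqrt_sq hn]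

/-- **Points are polar for the Brownian bridge in `ℝ³`**: for `t > 0` and any `x, y, z`, almost
surely the bridge of duration `t` from `x` to `y` does not visit `z` at any time `s ∈ (0, t)`.
Covering argument: on the event that the driving path has Lévy modulus constant `M`, a visit to
`z` at `s ∈ [δ, t − δ]` forces `dist (X_u, z) ≤ A√((n+1)2⁻ⁿ)` at a dyadic grid point of every
fine scale `n`, an event of probability `O((n+1)^{3/2} 2^{-n/2})` by the small-ball estimate.
[folklore] -/
theorem measure_exists_bridgePath_eq_zero {t : ℝ≥0} (ht : t ≠ 0) (x y z : E3) :
    wienerQuad {ω | ∃ s : ℝ≥0, 0 < s ∧ s < t ∧ bridgePath t x y ω s = z} = 0 := by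
  have htpos : (0 : ℝ) < t := by exact_mod_cast pos_iff_ne_zero.2 ht
  set N : ℕ := ⌈(t : ℝ)⌉₊ with hN
  have htN : (t : ℝ) ≤ N := Nat.le_ceil _
  -- the pieces of the cover
  set F : ℕ → ℕ → Set WienerQuad := fun m M =>
    {ω | (∀ (n : ℕ) (s u : ℝ≥0), s ≤ N → u ≤ N → dist s u ≤ (2 ^ n)⁻¹ →
        dist (bm3 s ω) (bm3 u ω) ≤ M * Real.sqrt ((n + 1) / 2 ^ n)) ∧ ‖bm3 t ω‖ ≤ M ∧
      ∃ s : ℝ≥0, (1 : ℝ) / (m + 1) ≤ s ∧ (s : ℝ) + 1 / (m + 1) ≤ t ∧ bridgePath t x y ω s = z}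
    with hFdef
  set Bad : Set WienerQuad := {ω | ¬ ∃ C : ℝ, ∀ (n : ℕ) (s u : ℝ≥0), s ≤ N → u ≤ N →
      dist s u ≤ (2 ^ n)⁻¹ → dist (bm3 s ω) (bm3 u ω) ≤ C * Real.sqrt ((n + 1) / 2 ^ n)}
    with hBad
  have hBad0 : wienerQuad Bad = 0 := ae_iff.1 (ae_modulus_bm3 N)
  -- each piece is null
  have hF : ∀ m M : ℕ, wienerQuad (F m M) = 0 := by
    intro m M
    set δ : ℝ := 1 / (m + 1) with hδ
    have hδ0 : 0 < δ := by positivity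
    set A : ℝ := ‖y - x‖ / t + M + M / t with hA
    have hA0 : 0 ≤ A := by positivity
    set r : ℕ → ℝ := fun n => ((t : ℝ) + 1) * (2 * t / (δ * Real.sqrt (π * δ))) ^ 3 * A ^ 3 *
      ((n + 1) * Real.sqrt ((n + 1) / 2 ^ n)) with hr
    have hr0 : Tendsto (fun n => ENNReal.ofReal (r n)) atTop (𝓝 0) := by
      have := (tendsto_succ_mul_sqrt.const_mul
        (((t : ℝ) + 1) * (2 * t / (δ * Real.sqrt (π * δ))) ^ 3 * A ^ 3))
      rw [mul_zero] at this
      have h := ENNReal.tendsto_ofReal this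
      rwa [ENNReal.ofReal_zero] at h
    have hev : ∀ᶠ n : ℕ in atTop, ((2 : ℝ) ^ n)⁻¹ ≤ δ / 2 := by
      have h : Tendsto (fun n : ℕ => ((2 : ℝ) ^ n)⁻¹) atTop (𝓝 0) :=
        tendsto_inv_atTop_zero.comp (tendsto_pow_atTop_atTop_of_one_lt one_lt_two)
      exact h.eventually_le_const (by positivity)
    refine le_antisymm (ge_of_tendsto hr0 ?_) bot_le
    filter_upwards [hev] with n hn
    refine (measure_mono fun ω hω => ?_).trans (measure_grid_le t x y z hδ0 hA0 n)
    have hω' : ω ∈ F m M := hω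
    simp only [hFdef, mem_setOf_eq] at hω'
    obtain ⟨hmod, hBt, s, hs1, hs2, hsz⟩ := hω'
    obtain ⟨k, hk1, hk2, hk3⟩ := exists_grid_near htN hmod hBt hs1 hs2 hsz hn
    simp only [mem_iUnion, Finset.mem_filter, Finset.mem_range, exists_prop]
    refine ⟨k, ⟨?_, hk1, hk2⟩, hk3⟩
    have h2 : (0 : ℝ) < 2 ^ n := by positivity
    have hkt : (k : ℝ) ≤ (t : ℝ) * 2 ^ n := by
      rw [div_le_iff₀ h2] at hk2
      nlinarith
    exact Nat.lt_succ_of_le (Nat.le_floor hkt)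
  -- the cover
  have hcover : {ω | ∃ s : ℝ≥0, 0 < s ∧ s < t ∧ bridgePath t x y ω s = z}
      ⊆ Bad ∪ ⋃ m : ℕ, ⋃ M : ℕ, F m M := by
    intro ω hω
    obtain ⟨s, hs0, hst, hsz⟩ := hω
    by_cases hbad : ω ∈ Bad
    · exact Or.inl hbad
    right
    have hbad' : ∃ C : ℝ, ∀ (n : ℕ) (s u : ℝ≥0), s ≤ N → u ≤ N →
        dist s u ≤ (2 ^ n)⁻¹ → dist (bm3 s ω) (bm3 u ω) ≤ C * Real.sqrt ((n + 1) / 2 ^ n) := by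
      by_contra hC
      exact hbad hC
    obtain ⟨C, hC⟩ := hbad'
    -- the integer bounds
    obtain ⟨M, hM⟩ := exists_nat_ge (max C ‖bm3 t ω‖)
    have hCM : C ≤ M := (le_max_left _ _).trans hM
    have hBM : ‖bm3 t ω‖ ≤ M := (le_max_right _ _).trans hM
    have hst' : (s : ℝ) < t := by exact_mod_cast hst
    have hs0' : (0 : ℝ) < s := by exact_mod_cast hs0
    have hε : 0 < min (s : ℝ) (t - s) := lt_min hs0' (by linarith)
    obtain ⟨m, hm⟩ := exists_nat_one_div_lt hε
    simp only [mem_iUnion]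
    refine ⟨m, M, ?_⟩
    show ω ∈ F m M
    simp only [hFdef, mem_setOf_eq]
    refine ⟨fun n s' u' hs' hu' hd => (hC n s' u' hs' hu' hd).trans
      (mul_le_mul_of_nonneg_right hCM (Real.sqrt_nonneg _)), hBM, s, ?_, ?_, hsz⟩
    · exact hm.le.trans (min_le_left _ _)
    · have := hm.le.trans (min_le_right _ _)
      linarith
  refine measure_mono_null hcover (measure_union_null hBad0 ?_)
  exact measure_iUnion_null fun m => measure_iUnion_null fun M => hF m M

/-- **The range of the Brownian bridge misses a given point almost surely** (other than its
endpoints): `P(z ∈ {X_s : 0 ≤ s ≤ t}) = 0` for `z ∉ {x, y}`. [folklore] -/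
theorem measure_mem_bridgeRange_eq_zero (t : ℝ≥0) {x y z : E3} (hzx : z ≠ x) (hzy : z ≠ y) :
    wienerQuad {ω | z ∈ (bridgeRange t x y ω : Set E3)} = 0 := by
  by_cases ht : t = 0
  · have hempty : {ω : WienerQuad | z ∈ (bridgeRange t x y ω : Set E3)} = ∅ := by
      ext ω
      simp only [mem_setOf_eq, mem_empty_iff_false, iff_false]
      rintro ⟨s, hs, hsz⟩
      have hs0 : s = 0 := le_antisymm (ht ▸ hs.2) bot_le
      rw [hs0, bridgePath_zero] at hsz
      exact hzx hsz.symm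
    rw [hempty, measure_empty]
  refine measure_mono_null (fun ω hω => ?_) (measure_exists_bridgePath_eq_zero ht x y z)
  obtain ⟨s, ⟨hs0, hst⟩, hsz⟩ := hω
  rcases eq_or_lt_of_le hs0 with h0 | h0
  · rw [← h0, bridgePath_zero] at hsz
    exact absurd hsz.symm hzx
  rcases eq_or_lt_of_le hst with h1 | h1
  · rw [h1, bridgePath_self ht] at hsz
    exact absurd hsz.symm hzy
  exact ⟨s, h0, h1, hsz⟩

end BrownianBridgeToPoint3

end Literature.Probability.Process
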